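import Literature.Geometry.Riemannian.KernelPotentialBounds
import Literature.Geometry.Riemannian.HeatKernelGaussianIntegralBound
import HarnessLib

/-!
# The lower volume bound for distance balls around an `H_n`-centre
# (Bamler 2020a, Thm. 6.2, in kernel form)

R. Bamler, *Entropy and heat kernel bounds on a Ricci flow background*, arXiv:2008.07093 (2020a),
§6.1, Thm. 6.2 (arXiv v1: Thm. 23): on a Ricci flow with `R(·, t − τ) ≥ R_min`, if `(z, t − τ)`
is an `H_n`-centre of `(x, t)`, then

  `|B(z, t − τ, √(2 H_n τ))|_{t−τ} ≥ c exp(𝒩_{x,t}(τ)) τ^{n/2}`,   `c = c(R_min τ) > 0`.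

This file PROVES the bound (`riemVolume_ball_ge_of_hCenter`), with the explicit constant that
Bamler's proof (§6.3) produces, for a Ricci flow `hflow = (h, cov)` on `[a, T]` of a `C^∞`
family of Riemannian metrics on a closed connected manifold `M` modelled on `ℝᵐ`, `m ≥ 3`,
`a < s < t ≤ T`, `τ = t − s`, the conjugate heat kernel measure `ν = ν_{x,t;s} = K dV_s`
(`heatKernelMeasure`, `K = IsRicciFlow.heatKernelFn`), the pointed Nash entropy
`𝒩 = 𝒩_{x,t}(τ) = pointedNashEntropy h (K t x (·, ·)) m t s` and an `H_m`-centre `z` of `(x, t)`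
at time `s` in the variance form `∫ d_s(z, ·)² dν ≤ H_m τ`, `H_m = (m − 1)π²/2 + 4`:

  `|{d_s(z, ·) < √(2 H_m τ)}|_s ≥ ½ (4πτ)^{m/2} e^{m/2} e^{−2 √(m − 2 R_min τ)} e^{𝒩}`.

Proof (Bamler 2020a, §6.3, done directly at scale `τ`, no parabolic rescaling). Let `B` be the
ball, `β = ν(B)` and `f` the potential, `K = (4πτ)^{-m/2} e^{-f}`.
* `β ≥ 1/2`: Chebyshev for the variance bound (Bamler's Prop. 3.11 with `A = 2`, here for the
  CLOSED complement `{√(2 H_m τ) ≤ d_s(z, ·)}`, `measure_setOf_sqrt_le_le_half`).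
* `∫ |f − 𝒩 − m/2| dν ≤ √(m − 2 R_min τ) =: D`: Bamler's Prop. 5.1 bound
  `∫ (f − 𝒩 − m/2)² dν ≤ m − 2 R_min τ` (`IsRicciFlow.integral_sq_entropyPotential_sub_kernel_le`,
  `KernelPotentialBounds.lean`) and Cauchy–Schwarz (`sq_integral_abs_mul_le`); hence
  `∫_B f dν ≥ (𝒩 + m/2) β − D`.
* Jensen for `u ↦ u log u` and the normalised volume of `B`, in the elementary form "integrate
  the tangent line `u log λ + u − λ ≤ u log u` at `λ = β/|B|` over `B`"
  (`mul_log_div_le_setIntegral_mul_log`):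
  `β log(β/|B|) ≤ ∫_B K log K dV_s = −∫_B f dν − (m/2) log(4πτ) β`
  `≤ −(𝒩 + m/2)β + D − (m/2) log(4πτ) β`.
* Hence `log |B| ≥ log β + 𝒩 + m/2 + (m/2) log(4πτ) − D/β ≥ −log 2 + 𝒩 + m/2 + (m/2) log(4πτ) − 2D`.

Everything is proved; no definitions, no named facts. What is NOT here: `H_n`-centres as a
definition and their existence (Bamler 2020a, Prop. 3.13), the upper volume bound (Thm. 6.1),
the rescaled form with a constant `c(R_min τ)` only, non-compact `M`.

## References

* R. H. Bamler, *Entropy and heat kernel bounds on a Ricci flow background*, arXiv:2008.07093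
  (2020), §3.1 Prop. 3.11, §5.1, §6.1 Thm. 6.2, §6.3 (its proof). [Bamler2020Entropy]
-/

noncomputable section

open Bundle Set Function Filter Manifold MeasureTheory Measure TopologicalSpace
open scoped Manifold ContDiff Topology ENNReal NNReal

namespace Literature.Geometry.Riemannian

open Lorentzian Lorentzian.PseudoRiemannianMetric

section LowerVolumeBound

/-- **Chebyshev for the distance from a centre, closed form** (Bamler 2020a, Prop. 3.11 with
`A = 2`): if `∫⁻ f² dν ≤ c` with `c > 0` for a continuous `f : X → [0, ∞]` (e.g. `f = d(z, ·)`),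
then `ν {y | √(2c) ≤ f y} ≤ 1/2` — Markov's inequality for `f²` at level `2c`.
[cite: Bamler2020Entropy, §3.1, Prop. 3.11] -/
theorem measure_setOf_sqrt_le_le_half {X : Type*} [TopologicalSpace X] [MeasurableSpace X]
    [OpensMeasurableSpace X] (ν : Measure X) {f : X → ℝ≥0∞} (hf : Continuous f) {c : ℝ}
    (hc : 0 < c) (hν : ∫⁻ y, f y ^ 2 ∂ν ≤ ENNReal.ofReal c) :
    ν {y | ENNReal.ofReal (Real.sqrt (2 * c)) ≤ f y} ≤ 2⁻¹ := by
  have hf2 : Measurable fun y ↦ f y ^ 2 := ((ENNReal.continuous_pow 2).comp hf).measurable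
  have hmarkov := mul_meas_ge_le_lintegral₀ (μ := ν) hf2.aemeasurable (ENNReal.ofReal (2 * c))
  have hsub : {y | ENNReal.ofReal (Real.sqrt (2 * c)) ≤ f y} ⊆
      {y | ENNReal.ofReal (2 * c) ≤ f y ^ 2} := by
    intro y hy
    rw [mem_setOf_eq] at hy ⊢
    rw [← Real.sq_sqrt (by positivity : (0 : ℝ) ≤ 2 * c), ENNReal.ofReal_pow (Real.sqrt_nonneg _)]
    exact pow_le_pow_left' hy 2
  have hc0 : ENNReal.ofReal c ≠ 0 := by simpa using hc
  have h2c : ENNReal.ofReal (2 * c) = ENNReal.ofReal c * 2 := by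
    rw [mul_comm, ENNReal.ofReal_mul hc.le, ENNReal.ofReal_ofNat]
  have hle : ENNReal.ofReal c * (2 * ν {y | ENNReal.ofReal (Real.sqrt (2 * c)) ≤ f y}) ≤
      ENNReal.ofReal c * 1 := by
    calc ENNReal.ofReal c * (2 * ν {y | ENNReal.ofReal (Real.sqrt (2 * c)) ≤ f y})
        ≤ ENNReal.ofReal c * (2 * ν {y | ENNReal.ofReal (2 * c) ≤ f y ^ 2}) := by
          gcongr
      _ = ENNReal.ofReal (2 * c) * ν {y | ENNReal.ofReal (2 * c) ≤ f y ^ 2} := by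
          rw [h2c, mul_assoc]
      _ ≤ ENNReal.ofReal c := hmarkov.trans hν
      _ = ENNReal.ofReal c * 1 := (mul_one _).symm
  have h2 := (ENNReal.mul_le_mul_iff_right hc0 ENNReal.ofReal_ne_top).1 hle
  rw [mul_comm] at h2
  exact (ENNReal.le_inv_iff_mul_le).2 h2

/-- The tangent line of the convex function `u ↦ u log u` at `l > 0` lies below its graph:
`u log l + u − l ≤ u log u` for `u > 0` (i.e. `log(l/u) ≤ l/u − 1`). [folklore] -/
theorem mul_log_add_sub_le_mul_log {u l : ℝ} (hu : 0 < u) (hl : 0 < l) :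
    u * Real.log l + u - l ≤ u * Real.log u := by
  have h := Real.log_le_sub_one_of_pos (div_pos hl hu)
  rw [Real.log_div hl.ne' hu.ne'] at h
  have h2 := mul_le_mul_of_nonneg_left h hu.le
  have e : u * (l / u - 1) = l - u := by
    rw [mul_sub, mul_div_cancel₀ _ hu.ne', mul_one]
  rw [e, mul_sub] at h2
  linarith

/-- **Jensen's inequality for `u log u` on a set of finite positive measure**, in tangent-line
form: for `K > 0` integrable on `B` together with `K log K`, `β = ∫_B K dV > 0` and
`|B| = V(B) > 0`, `β log(β/|B|) ≤ ∫_B K log K dV` (integrate `K log λ + K − λ ≤ K log K` over `B`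
with `λ = β/|B|`). [folklore] -/
theorem mul_log_div_le_setIntegral_mul_log {X : Type*} [MeasurableSpace X] {V : Measure X}
    [IsFiniteMeasure V] {B : Set X} {K : X → ℝ} (hK : ∀ y, 0 < K y) (hKi : IntegrableOn K B V)
    (hKlog : IntegrableOn (fun y ↦ K y * Real.log (K y)) B V) (hP : 0 < V.real B)
    (hβ : 0 < ∫ y in B, K y ∂V) :
    (∫ y in B, K y ∂V) * Real.log ((∫ y in B, K y ∂V) / V.real B) ≤
      ∫ y in B, K y * Real.log (K y) ∂V := by
  have hl : 0 < (∫ y in B, K y ∂V) / V.real B := div_pos hβ hP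
  have hI1 : IntegrableOn (fun y ↦ K y * Real.log ((∫ y in B, K y ∂V) / V.real B)) B V :=
    hKi.mul_const _
  have h1 : ∫ y in B, (K y * Real.log ((∫ y in B, K y ∂V) / V.real B) + K y -
      (∫ y in B, K y ∂V) / V.real B) ∂V ≤ ∫ y in B, K y * Real.log (K y) ∂V :=
    integral_mono ((hI1.add hKi).sub (integrable_const _)) hKlog fun y ↦
      mul_log_add_sub_le_mul_log (hK y) hl
  have hI2 : IntegrableOn (fun y ↦ K y * Real.log ((∫ y in B, K y ∂V) / V.real B) + K y) B V :=
    hI1.add hKi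
  have hI3 : IntegrableOn (fun _ ↦ (∫ y in B, K y ∂V) / V.real B) B V := integrable_const _
  have h2 : ∫ y in B, (K y * Real.log ((∫ y in B, K y ∂V) / V.real B) + K y -
      (∫ y in B, K y ∂V) / V.real B) ∂V =
      (∫ y in B, K y ∂V) * Real.log ((∫ y in B, K y ∂V) / V.real B) := by
    rw [integral_sub hI2 hI3, integral_add hI1 hKi, integral_mul_const, setIntegral_const,
      smul_eq_mul, mul_div_cancel₀ _ hP.ne']
    ring
  rw [h2] at h1
  exact h1

/-- **Cauchy–Schwarz for a probability density**: `(∫ |g| K dV)² ≤ ∫ g² K dV` if `K ≥ 0` and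
`∫ K dV = 1` (expand `0 ≤ ∫ (|g| − ∫ |g| K)² K dV`). [folklore] -/
theorem sq_integral_abs_mul_le {X : Type*} [MeasurableSpace X] {V : Measure X} {g K : X → ℝ}
    (hK : ∀ y, 0 ≤ K y) (hK1 : ∫ y, K y ∂V = 1) (hKi : Integrable K V)
    (h1 : Integrable (fun y ↦ |g y| * K y) V) (h2 : Integrable (fun y ↦ g y ^ 2 * K y) V) :
    (∫ y, |g y| * K y ∂V) ^ 2 ≤ ∫ y, g y ^ 2 * K y ∂V := by
  have h0 : 0 ≤ ∫ y, (|g y| - ∫ y', |g y'| * K y' ∂V) ^ 2 * K y ∂V :=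
    integral_nonneg fun y ↦ mul_nonneg (sq_nonneg _) (hK y)
  have e : (fun y ↦ (|g y| - ∫ y', |g y'| * K y' ∂V) ^ 2 * K y) = fun y ↦
      g y ^ 2 * K y - 2 * (∫ y', |g y'| * K y' ∂V) * (|g y| * K y) +
        (∫ y', |g y'| * K y' ∂V) ^ 2 * K y := by
    funext y
    rw [← sq_abs (g y)]
    ring
  have hI2 : Integrable (fun y ↦ 2 * (∫ y', |g y'| * K y' ∂V) * (|g y| * K y)) V :=
    h1.const_mul _
  have hI3 : Integrable (fun y ↦ (∫ y', |g y'| * K y' ∂V) ^ 2 * K y) V := hKi.const_mul _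
  have hI4 : Integrable (fun y ↦ g y ^ 2 * K y -
      2 * (∫ y', |g y'| * K y' ∂V) * (|g y| * K y)) V := h2.sub hI2
  rw [e, integral_add hI4 hI3, integral_sub h2 hI2, integral_const_mul, integral_const_mul,
    hK1] at h0
  linarith

/-- **Lower volume bound for the distance ball around an `H_m`-centre** (Bamler 2020a, Thm. 6.2,
in kernel form; arXiv v1: Thm. 23). Let `(h, cov)` be a Ricci flow on `[a, T]` of a smooth family
of Riemannian metrics on a closed connected manifold `M` modelled on `ℝᵐ`, `m ≥ 3`,
`a < s < t ≤ T`, `τ = t − s`, `x ∈ M`, `ν = ν_{x,t;s}` the conjugate heat kernel measure,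
`𝒩 = 𝒩_{x,t}(τ)` the pointed Nash entropy of the kernel `K(x,t;·,·)`, `R(·, s) ≥ R_min`, and let
`z` be an `H_m`-centre of `(x, t)` at time `s`: `∫ d_s(z, y)² dν(y) ≤ H_m τ`,
`H_m = (m − 1)π²/2 + 4`. Then

  `½ (4πτ)^{m/2} e^{m/2} e^{−2√(m − 2 R_min τ)} e^{𝒩} ≤ Vol_s {y | d_s(z, y) < √(2 H_m τ)}`.

Proof: Bamler's §6.3 — `ν(B) ≥ 1/2` (Prop. 3.11), `∫ |f − 𝒩 − m/2| dν ≤ √(m − 2 R_min τ)`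
(Prop. 5.1 and Cauchy–Schwarz) and Jensen for `u log u` on `B`; see the module docstring.
[cite: Bamler2020Entropy, §6.1, Thm. 6.2] -/
theorem riemVolume_ball_ge_of_hCenter {m : ℕ} {H : Type*} [TopologicalSpace H]
    {I : ModelWithCorners ℝ (EuclideanSpace ℝ (Fin m)) H} [I.Boundaryless]
    {M : Type*} [TopologicalSpace M] [ChartedSpace H M] [IsManifold I ∞ M]
    [T2Space M] [CompactSpace M] [SecondCountableTopology M] [MeasurableSpace M] [BorelSpace M]
    [PreconnectedSpace M] [T3Space M]
    {h : ℝ → PseudoRiemannianMetric I ∞ (EuclideanSpace ℝ (Fin m)) (TangentSpace I : M → Type _)}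
    {cov : ℝ → CovariantDerivative I (EuclideanSpace ℝ (Fin m)) (TangentSpace I : M → Type _)}
    {a T : ℝ} (hflow : IsRicciFlow h cov (Icc a T))
    (hh : IsContMDiffFamilyOn ∞ h univ) (hR : ∀ r, (h r).IsRiemannian) (hm : 3 ≤ m) {s t : ℝ}
    (has : a < s) (hst : s < t) (htT : t ≤ T) (x z : M)
    (hz : ∫⁻ y, (h s).edist (hR s) z y ^ 2 ∂(heatKernelMeasure hh hR t x s) ≤
      ENNReal.ofReal ((((m : ℝ) - 1) * Real.pi ^ 2 / 2 + 4) * (t - s)))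
    {Rmin : ℝ} (hRmin : ∀ y, Rmin ≤ (h s).scalarCurvatureWith (cov s) y) :
    ENNReal.ofReal (1 / 2 * (4 * Real.pi * (t - s)) ^ ((m : ℝ) / 2) * Real.exp ((m : ℝ) / 2) *
        Real.exp (-2 * Real.sqrt ((m : ℝ) - 2 * Rmin * (t - s))) *
        Real.exp (pointedNashEntropy h (fun r y ↦ hflow.heatKernelFn hh hR t x (y, r)) m t s)) ≤
      (h s).riemVolume {y | (h s).edist (hR s) z y <
        ENNReal.ofReal (Real.sqrt (2 * ((((m : ℝ) - 1) * Real.pi ^ 2 / 2 + 4) * (t - s))))} := by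
  haveI : IsFiniteMeasure (h s).riemVolume := ⟨(h s).riemVolume_univ_lt_top⟩
  have ht : t ∈ Ioc a T := ⟨has.trans hst, htT⟩
  have hs : s ∈ Ioo a t := ⟨has, hst⟩
  have hτ : 0 < t - s := sub_pos.2 hst
  have hmR : (3 : ℝ) ≤ m := by exact_mod_cast hm
  -- abbreviations
  set V : Measure M := (h s).riemVolume with hV
  set ν : Measure M := heatKernelMeasure hh hR t x s with hν
  set u : ℝ → M → ℝ := fun r y ↦ hflow.heatKernelFn hh hR t x (y, r) with hu
  set K : M → ℝ := fun y ↦ hflow.heatKernelFn hh hR t x (y, s) with hK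
  set N : ℝ := pointedNashEntropy h u m t s with hN
  set Hm : ℝ := ((m : ℝ) - 1) * Real.pi ^ 2 / 2 + 4 with hHm
  set ρ : ℝ := Real.sqrt (2 * (Hm * (t - s))) with hρ
  set B : Set M := {y | (h s).edist (hR s) z y < ENNReal.ofReal ρ} with hB
  set D : ℝ := Real.sqrt ((m : ℝ) - 2 * Rmin * (t - s)) with hD
  set c₁ : ℝ := Real.log (4 * Real.pi * (t - s)) * ((m : ℝ) / 2) with hc₁
  set g : M → ℝ := fun y ↦ entropyPotential u m t s y - (N + (m : ℝ) / 2) with hg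
  -- basic facts on `K` and the potential
  have hKpos : ∀ y, 0 < K y := fun y ↦ hflow.heatKernelFn_pos hh hR ht x ⟨mem_univ _, hs⟩
  have hKs : ContMDiff I 𝓘(ℝ, ℝ) ∞ K := hflow.contMDiff_heatKernelFn_slice hh hR ht x hs
  have hKc : Continuous K := hKs.continuous
  have hlogc : Continuous fun y ↦ Real.log (K y) :=
    Real.continuousOn_log.comp_continuous hKc fun y ↦ (hKpos y).ne'
  have hfs : ContMDiff I 𝓘(ℝ, ℝ) ∞ (entropyPotential u m t s) := contMDiff_neg_log_sub hKs hKpos _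
  have hgc : Continuous g := hfs.continuous.sub continuous_const
  have hgac : Continuous fun y ↦ |g y| := continuous_abs.comp hgc
  have hi : ∀ {φ : M → ℝ}, Continuous φ → Integrable φ V := fun hφ ↦
    hφ.integrable_of_hasCompactSupport (HasCompactSupport.of_compactSpace _)
  have hmass : ∫ y, K y ∂V = 1 := hflow.integral_heatKernelFn_eq_one hh hR ht x hs
  have hνint : ∀ φ : M → ℝ, ∫ y, φ y ∂ν = ∫ y, φ y * K y ∂V := fun φ ↦
    hflow.integral_heatKernelMeasure_eq_integral_mul_heatKernelFn hh hR ht x hs φ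
  -- Bamler's Prop. 5.1 bound `∫ (f − 𝒩 − m/2)² K dV ≤ m − 2 R_min τ = D²`
  have hsq : ∫ y, g y ^ 2 * K y ∂V ≤ (m : ℝ) - 2 * Rmin * (t - s) :=
    hflow.integral_sq_entropyPotential_sub_kernel_le hh hR hm ht x hs hRmin
  -- Cauchy–Schwarz: `∫ |g| K dV ≤ D`
  have hA : ∫ y, |g y| * K y ∂V ≤ D := by
    have h2 := sq_integral_abs_mul_le (fun y ↦ (hKpos y).le) hmass (hi hKc) (hi (hgac.mul hKc))
      (hi ((hgc.pow 2).mul hKc))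
    have hA0 : 0 ≤ ∫ y, |g y| * K y ∂V :=
      integral_nonneg fun y ↦ mul_nonneg (abs_nonneg _) (hKpos y).le
    rw [hD, ← Real.sqrt_sq hA0]
    exact Real.sqrt_le_sqrt (h2.trans hsq)
  -- the ball `B`: open, measurable, contains `z`, of positive finite volume
  have hcont : Continuous fun y ↦ (h s).edist (hR s) z y :=
    ((h s).continuous_edist (hR s)).comp (.prodMk_right z)
  have hBo : IsOpen B := isOpen_setOf_edist_lt (hR s) z _
  have hBm : MeasurableSet B := hBo.measurableSet
  have hHm0 : 0 < Hm := by
    have h1 : (0 : ℝ) ≤ ((m : ℝ) - 1) * Real.pi ^ 2 / 2 :=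
      div_nonneg (mul_nonneg (by linarith) (sq_nonneg _)) zero_le_two
    rw [hHm]
    linarith
  have hHmτ : 0 < Hm * (t - s) := mul_pos hHm0 hτ
  have hρ0 : 0 < ρ := Real.sqrt_pos.2 (by positivity)
  have hzB : z ∈ B := by
    show (h s).edist (hR s) z z < ENNReal.ofReal ρ
    rw [PseudoRiemannianMetric.edist_self]
    exact ENNReal.ofReal_pos.2 hρ0
  have hVB0 : 0 < V B := by
    rw [hV, riemVolume_eq (hR s)]
    haveI := isOpenPosMeasure_riemannianMeasure ((h s).toContMDiffRiemannianMetric (hR s))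
    exact hBo.measure_pos _ ⟨z, hzB⟩
  have hVBtop : V B ≠ ⊤ := measure_ne_top V B
  have hP0 : 0 < V.real B := ENNReal.toReal_pos hVB0.ne' hVBtop
  -- `β = ν(B) = ∫_B K dV ≥ 1/2` (Chebyshev, Bamler's Prop. 3.11)
  have hβν : ν.real B = ∫ y in B, K y ∂V := by
    rw [← integral_indicator_one hBm, hνint (B.indicator 1), ← integral_indicator hBm]
    refine integral_congr_ae (Eventually.of_forall fun y ↦ ?_)
    by_cases hy : y ∈ B <;> simp [hy]
  have hβ : 1 / 2 ≤ ∫ y in B, K y ∂V := by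
    have hC : ν {y | ENNReal.ofReal ρ ≤ (h s).edist (hR s) z y} ≤ 2⁻¹ :=
      measure_setOf_sqrt_le_le_half ν hcont hHmτ hz
    have hBc : Bᶜ = {y | ENNReal.ofReal ρ ≤ (h s).edist (hR s) z y} := by
      ext y
      simp [hB]
    have hCreal : ν.real Bᶜ ≤ 2⁻¹ := by
      rw [hBc, measureReal_def]
      have := ENNReal.toReal_mono (by simp) hC
      simpa using this
    have hsum := measureReal_add_measureReal_compl (μ := ν) hBm
    rw [probReal_univ] at hsum
    rw [← hβν]
    linarith
  have hβ0 : 0 < ∫ y in B, K y ∂V := by linarith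
  -- Jensen (tangent line of `u log u` at `β/|B|`): `β log β − β log |B| ≤ ∫_B K log K dV`
  have hJ : (∫ y in B, K y ∂V) * Real.log (∫ y in B, K y ∂V) -
      (∫ y in B, K y ∂V) * Real.log (V.real B) ≤ ∫ y in B, K y * Real.log (K y) ∂V := by
    have h1 := mul_log_div_le_setIntegral_mul_log hKpos (hi hKc).integrableOn
      (hi (hKc.mul hlogc)).integrableOn hP0 hβ0
    rw [Real.log_div hβ0.ne' hP0.ne', mul_sub] at h1
    exact h1
  -- `K log K = −g K − (c₁ + 𝒩 + m/2) K`, integrated over `B`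
  have hKlog : ∀ y, K y * Real.log (K y) = -(g y * K y) - (c₁ + N + (m : ℝ) / 2) * K y := by
    intro y
    have e : g y = -Real.log (K y) - (m : ℝ) / 2 * Real.log (4 * Real.pi * (t - s)) -
        (N + (m : ℝ) / 2) := rfl
    rw [e]
    ring
  have hIlog : ∫ y in B, K y * Real.log (K y) ∂V =
      -(∫ y in B, g y * K y ∂V) - (c₁ + N + (m : ℝ) / 2) * ∫ y in B, K y ∂V := by
    have e : (fun y ↦ K y * Real.log (K y)) =
        fun y ↦ -(g y * K y) - (c₁ + N + (m : ℝ) / 2) * K y := funext hKlog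
    have hIn : IntegrableOn (fun y ↦ -(g y * K y)) B V := (hi (hgc.mul hKc)).integrableOn.neg
    rw [e, integral_sub hIn ((hi hKc).integrableOn.const_mul _), integral_neg, integral_const_mul]
  -- `−∫_B g K ≤ ∫_B |g| K ≤ ∫ |g| K ≤ D`
  have hgB : -(∫ y in B, g y * K y ∂V) ≤ D := by
    have h1 : ∫ y in B, -(|g y| * K y) ∂V ≤ ∫ y in B, g y * K y ∂V :=
      integral_mono (hi (hgac.mul hKc)).integrableOn.neg (hi (hgc.mul hKc)).integrableOn
        fun y ↦ by
          rw [← neg_mul]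
          exact mul_le_mul_of_nonneg_right (neg_abs_le _) (hKpos y).le
    rw [integral_neg] at h1
    have h2 : ∫ y in B, |g y| * K y ∂V ≤ ∫ y, |g y| * K y ∂V :=
      setIntegral_le_integral (hi (hgac.mul hKc))
        (Eventually.of_forall fun y ↦ mul_nonneg (abs_nonneg _) (hKpos y).le)
    linarith
  -- combine: `β log |B| ≥ β log β + (c₁ + 𝒩 + m/2) β − D ≥ β (log ½ + c₁ + m/2 − 2D + 𝒩)`
  set β : ℝ := ∫ y in B, K y ∂V with hβdef
  have hD0 : 0 ≤ D := Real.sqrt_nonneg _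
  have hlogβ : β * Real.log (1 / 2) ≤ β * Real.log β :=
    mul_le_mul_of_nonneg_left (Real.log_le_log (by norm_num) hβ) hβ0.le
  have hDβ : D ≤ 2 * D * β := by nlinarith
  have hmain : β * (Real.log (1 / 2) + c₁ + (m : ℝ) / 2 + -2 * D + N) ≤
      β * Real.log (V.real B) := by
    linarith
  have hL : Real.log (1 / 2) + c₁ + (m : ℝ) / 2 + -2 * D + N ≤ Real.log (V.real B) :=
    le_of_mul_le_mul_left hmain hβ0
  have hexp := Real.exp_le_exp.2 hL
  rw [Real.exp_log hP0] at hexp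
  -- identify the constant and conclude
  have h4πτ : 0 < 4 * Real.pi * (t - s) := by positivity
  have hE : Real.exp (Real.log (1 / 2) + c₁ + (m : ℝ) / 2 + -2 * D + N) =
      1 / 2 * (4 * Real.pi * (t - s)) ^ ((m : ℝ) / 2) * Real.exp ((m : ℝ) / 2) *
        Real.exp (-2 * D) * Real.exp N := by
    simp only [Real.exp_add]
    rw [Real.exp_log (by norm_num : (0 : ℝ) < 1 / 2), hc₁, ← Real.rpow_def_of_pos h4πτ]
  rw [hE, measureReal_def] at hexp
  exact ENNReal.ofReal_le_of_le_toReal hexp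

end LowerVolumeBound

end Literature.Geometry.Riemannian

end
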